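import Mathlib
import Summits.Ventures.PercRepro2.CoinChainXAJpGateAll
import Summits.Ventures.PercRepro2.CoinChainReductionGen
import Summits.Ventures.PercRepro2.CoinChainHeadHyps

/-!
# Row 2′DARC at the AND-switch chain with one sure entry `m`, the coin entries `{j, j'}` and the markers `(j, j')`
(blind cell PercRepro2, night-2 g29; proofs/NIGHT2-DARC.md §71)

`darc_of_chain_jp`: the general chain (`a` entered from the sure entry `m ∈ U` and from `a'` by the coin, `a'` entered
from `{j, j'} ⊆ U` surely; chain data `ν = P(level)`, `c = chainC`, `d = chainD`, `d' = chainD'`; the markers are the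
two coin entries `j`, `j'`; an lsm core; positive world masses and ideal mass; positive coin-law masses on the fibres
`mjj'` and `jj'`) satisfies `DARC pr arcs s {t} j j' a w` — with NO sign condition and NO restriction on the gate:
`chain_darc_of_functional` with `chain_functional_nonneg_jp` (the two sign families of the coefficient `γ_m` united).
The positive `c`-mass on the `∅`-fibre that family A needs is the ideal mass `hmI` itself.
-/

namespace Summit.Ventures.PercRepro2.Coin

open Classical

section JpDarc

variable {V : Type*} {E : Type*} [Fintype V] [DecidableEq V] [Fintype E] [DecidableEq E]
  {R : Type*} [Field R] [LinearOrder R] [IsStrictOrderedRing R]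
  {arcs : E → Finset (V × V)} {s : V} {U : Finset V} {c' c : V → E}
  {a' a w : V}

omit [Fintype V] [Fintype E] [DecidableEq E] in
/-- The ideal of the entry set `{m} ∪ {j, j'}` is the `∅`-fibre over `{m, j, j'}`. -/
lemma filter_ideal_eq_fibre_empty (U : Finset V) (m j j' : V) :
    U.powerset.filter (fun W => ¬ ∃ r ∈ ({m} : Finset V) ∪ {j, j'}, r ∈ W) =
      U.powerset.filter (fun W => m ∉ W ∧ j ∉ W ∧ j' ∉ W) := by
  apply Finset.filter_congr
  intro W _
  simp only [Finset.mem_union, Finset.mem_singleton, Finset.mem_insert, not_exists, not_and]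
  constructor
  · rintro h
    exact ⟨h m (Or.inl rfl), h j (Or.inr (Or.inl rfl)), h j' (Or.inr (Or.inr rfl))⟩
  · rintro ⟨h1, h2, h3⟩ r hr
    rcases hr with rfl | rfl | rfl <;> assumption

/-- **ROW 2′DARC AT THE GENERAL AND-SWITCH CHAIN WITH ONE SURE ENTRY `m`, THE COIN ENTRIES `{j, j'}` AND THE MARKERS
`(j, j')`** (chain data `ν = P(level)`, `c = chainC`, `d = chainD`, `d' = chainD'`, an lsm core, positive world masses and
ideal mass, positive coin-law masses on the fibres `mjj'` and `jj'`): `DARC pr arcs s {t} j j' a w`, unconditionally. -/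
theorem darc_of_chain_jp (pr : E → R) (hp : IsProbVec pr) (hS : SameEnds arcs)
    {m j j' : V}
    (h' : OrTailK arcs s U {j, j'} c' a') (hsure' : ∀ r ∈ ({j, j'} : Finset V), pr (c' r) = 1)
    (h : OrTailK arcs s (insert a' U) (insert a' {m}) c a) (hsure : pr (c m) = 1)
    (hm : m ∈ U) (hjU : j ∈ U) (hj'U : j' ∈ U)
    (hν : ∀ W W', W ⊆ U → W' ⊆ U →
      prob pr (coreLevel arcs s U W) * prob pr (coreLevel arcs s U W') ≤
        prob pr (coreLevel arcs s U (W ∩ W')) * prob pr (coreLevel arcs s U (W ∪ W')))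
    {t : V} (htC : t ∉ insert a (insert a' U)) (hts : t ≠ s) (hws : w ≠ s)
    (hwC : w ∉ insert a (insert a' U))
    (hpos0 : 0 < ∑ W ∈ U.powerset, prob pr (coreLevel arcs s U W) *
      chainMix {m} {j, j'} 0 (chainC pr arcs s t U {j, j'} a' a) (chainD pr arcs s t U {j, j'} a' a) W)
    (hpos1 : 0 < ∑ W ∈ U.powerset, prob pr (coreLevel arcs s U W) *
      chainMix {m} {j, j'} 1 (chainC pr arcs s t U {j, j'} a' a) (chainD pr arcs s t U {j, j'} a' a) W)
    (hmI : 0 < ∑ W ∈ U.powerset.filter (fun W => ¬ ∃ r ∈ ({m} : Finset V) ∪ {j, j'}, r ∈ W),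
      prob pr (coreLevel arcs s U W) * chainC pr arcs s t U {j, j'} a' a W)
    (hU : 0 < ∑ W ∈ U.powerset.filter (fun W => m ∈ W ∧ j ∈ W ∧ j' ∈ W),
      prob pr (coreLevel arcs s U W) * chainD pr arcs s t U {j, j'} a' a W)
    (hJJ : 0 < ∑ W ∈ U.powerset.filter (fun W => m ∉ W ∧ j ∈ W ∧ j' ∈ W),
      prob pr (coreLevel arcs s U W) * chainD pr arcs s t U {j, j'} a' a W) :
    DARC pr arcs s {t} j j' a w := by
  obtain ⟨hA0, hAmono, hAlsm⟩ := OrTailU.head_props (U := insert a' U) (a := a) pr hp hS t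
  obtain ⟨hdc, hd'd, hcc, hdd, hd'd', hdd', hratio, hratio', -, hcd, hcd'⟩ :=
    chainPhi_head_hyps (fun X => prob pr (coreAvoidEvent arcs s t (insert a (insert a' U)) X))
      {j, j'} a' a w hA0 hAmono hAlsm
  have hsureM : ∀ r ∈ ({m} : Finset V), pr (c r) = 1 := by
    intro r hr
    rw [Finset.mem_singleton] at hr
    rw [hr]; exact hsure
  have hentU : ({m} : Finset V) ⊆ U := Finset.singleton_subset_iff.2 hm
  have hO : 0 < ∑ W ∈ U.powerset.filter (fun W => m ∉ W ∧ j ∉ W ∧ j' ∉ W),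
      prob pr (coreLevel arcs s U W) * chainC pr arcs s t U {j, j'} a' a W := by
    rw [← filter_ideal_eq_fibre_empty U m j j']; exact hmI
  refine chain_darc_of_functional pr hS h' hsure' h hsureM hentU hjU hj'U htC hts hws hwC ?_
  exact chain_functional_nonneg_jp U m j j' (fun W => prob pr (coreLevel arcs s U W))
    (chainC pr arcs s t U {j, j'} a' a) (chainD pr arcs s t U {j, j'} a' a) (chainD' pr arcs s t U {j, j'} a' a w)
    (pr (c a')) (hp.nonneg _) (hp.le_one _) (fun W => prob_nonneg hp _)
    (fun s' hs' t' ht' => hν s' t' hs' ht') (fun W => hA0 _) (fun W => hA0 _) (fun W => hA0 _)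
    hdc (fun W => le_trans (hd'd W) (hdc W)) hd'd hcc hdd hd'd' hcd hcd' hdd' hratio hratio'
    (fun W => if j ∈ W then (1 : R) else 0) (fun W => if j' ∈ W then (1 : R) else 0)
    (fun W => rfl) (fun W => rfl) hpos0 hpos1 hmI hU hJJ hO

end JpDarc

end Summit.Ventures.PercRepro2.Coin
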